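import Literature.NumberTheory.Sieve.Maynard2016Lemma7BadPrimes
import Literature.NumberTheory.Sieve.Maynard2016CubeEstimate

/-!
# Maynard (2016), Lemma 7: the `φ`-weighted coupled kernel on the cube is `(1+o(1)) 𝔖⁷ · M M'`

J. Maynard, *Large gaps between primes*, Ann. of Math. (2) 183 (2016), 915–933 = arXiv:1408.5110,
§6, proof of Lemma 7 ("By an argument analogous to that of Lemma 6 …", the analogue of displays
(6.16)–(6.18) for the sum `S_i` of solvable tuples).

For the `k − 1` free slots `ι = κ = {ℓ // ℓ ≠ i}`, the weight `phiInv = 1/φ`, the modulus `P_w`, the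
coupling `restrictPairs i i (couplingSet7 p₀ i)` and the bad primes `badPrimes7` the bricks
`K = E · N · Z · Z'` (`LcmEuler.coupledKernelW_eq_prod`), `‖E − 1‖ ≤ exp(T⁷) − 1`
(`LcmEuler.norm_coupledEpsProdW_sub_one_le`, `eventually_epsTotalW7_le`), `N = nuProd7` (exactly —
no `singLarge` approximation is made in Lemma 7; `nuProd7` IS the singular series of the per-tuple
statement `Lemma7MainLower`), `(φ(W)/W · log b)^{k−1} Z = M ∏R`, `∏R = 1 + o(1)`
(`Maynard2016ZetaRatio`) and `singSmall (k−1) = (φ(P_w)/P_w)^{−2(k−1)}` give, uniformly in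
`1 ≤ m ≤ x < p₀ ≤ x²` and in the cube `|ξ|,|ξ'|,|τ|,|τ'| ≤ √log x`:
`‖(log x)^{k−1} (log y)^{k−1} K − 𝔖⁷ M(ξ,ξ') M(τ,τ')‖ ≤ η 𝔖⁷ ‖M M'‖`, `𝔖⁷ = singSmall (k−1) x · nuProd7`
(`eventually_norm_kernelW7_sub_model_le`).  All statements PROVED.

## References

* J. Maynard, *Large gaps between primes*, Ann. of Math. (2) 183 (2016), 915–933; arXiv:1408.5110,
  §6, proof of Lemma 7; displays (6.16)–(6.18). [Maynard2016LargeGaps]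
-/

noncomputable section

open Filter Finset Real
open scoped BigOperators Topology

namespace Literature.NumberTheory.Sieve

namespace Maynard2016

open LcmEuler

/-! ### Small lemmas -/

/-- The free slots `{ℓ // ℓ ≠ i}` number `k − 1`. [cite: Maynard2016LargeGaps, Lemma 7 (proof, "(k−1)-dimensional sieve")] -/
theorem card_slots_ne_eq (k : ℕ) (i : Fin k) : Fintype.card {l : Fin k // l ≠ i} = k - 1 := by
  rw [Fintype.card_subtype, Finset.filter_ne', Finset.card_erase_of_mem (Finset.mem_univ i),
    Finset.card_univ, Fintype.card_fin]

/-- `LcmEuler.nuProd (P_w) m (restrictPairs i i couplingSet7) Bad⁷ = nuProd7` (cast).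
[cite: Maynard2016LargeGaps, Lemma 7 (proof, display (6.16))] -/
theorem nuProd_seven_eq_ofReal (k x m p₀ : ℕ) (i : Fin k) :
    nuProd (Pw x) m (restrictPairs i i (couplingSet7 k x m p₀ i)) (badPrimes7 k x m p₀ i) =
      (nuProd7 k x m p₀ i : ℂ) := by
  unfold nuProd nuProd7
  push_cast
  rfl

/-- `0 < nuProd7`. [cite: Maynard2016LargeGaps, Lemma 7 (proof, display (6.16))] -/
theorem nuProd7_pos (k x m p₀ : ℕ) (i : Fin k) : 0 < nuProd7 k x m p₀ i :=
  lt_of_lt_of_le one_pos (one_le_nuProd7 k x m p₀ i)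

/-- `T⁷` is monotone-affine in `τ`: `T(cτ) ≤ c T(τ)` for `c ≥ 1`. [cite: Maynard2016LargeGaps, §6 display (6.14)] -/
theorem epsTotalW_mul_le (k k' p₀ : ℕ) (τ : ℝ) {c : ℝ} (hc : 1 ≤ c) (Bad : Finset ℕ) :
    epsTotalW k k' p₀ (c * τ) Bad ≤ c * epsTotalW k k' p₀ τ Bad := by
  unfold epsTotalW
  have hC : 0 ≤ badConstW k k' := badConstW_nonneg k k'
  have hS : 0 ≤ ∑ p ∈ Bad, Real.log p / p :=
    Finset.sum_nonneg fun p _ => div_nonneg (Real.log_natCast_nonneg p) (Nat.cast_nonneg p)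
  have h6 : (0 : ℝ) ≤ 6 ^ (k + k') := by positivity
  have hA : 0 ≤ 2 * badConstW k k' / p₀ := by positivity
  have hB : (0 : ℝ) ≤ 16 * (k' + k * k') := by positivity
  nlinarith [mul_nonneg h6 hA]

/-- `‖abcd − 1‖ ≤ 15δ` if each of `a, b, c, d` is within `δ ≤ 1` of `1`. [folklore] -/
private theorem norm_mul4_sub_one_le7 {a b c d : ℂ} {δ : ℝ} (hδ1 : δ ≤ 1) (ha : ‖a - 1‖ ≤ δ)
    (hb : ‖b - 1‖ ≤ δ) (hc : ‖c - 1‖ ≤ δ) (hd : ‖d - 1‖ ≤ δ) : ‖a * b * c * d - 1‖ ≤ 15 * δ := by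
  have hδ0 : 0 ≤ δ := (norm_nonneg _).trans ha
  have two : ∀ {u v : ℂ} {s t : ℝ}, 0 ≤ t → ‖u - 1‖ ≤ s → ‖v - 1‖ ≤ t →
      ‖u * v - 1‖ ≤ s * (1 + t) + t := by
    intro u v s t ht hu hv
    have e : u * v - 1 = (u - 1) * v + (v - 1) := by ring
    have hvn : ‖v‖ ≤ 1 + t := by
      have := norm_le_norm_add_norm_sub' v 1; rw [norm_one] at this; linarith [norm_sub_rev v 1]
    rw [e]
    refine (norm_add_le _ _).trans (add_le_add ?_ hv)
    rw [norm_mul]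
    exact mul_le_mul hu hvn (norm_nonneg _) ((norm_nonneg _).trans hu)
  have hab : ‖a * b - 1‖ ≤ 3 * δ := by have := two hδ0 ha hb; nlinarith
  have hcd : ‖c * d - 1‖ ≤ 3 * δ := by have := two hδ0 hc hd; nlinarith
  have := two (by positivity) hab hcd
  rw [show a * b * c * d = (a * b) * (c * d) by ring]
  nlinarith

/-! ### The cube estimate for Lemma 7 -/

/-- **The `φ`-weighted coupled kernel on the cube, uniformly in `m, p₀`** (the analogue of
(6.16)–(6.18) in the proof of Lemma 7).  For `0 < ε ≤ 1/2`, `k`, a slot `i` and `η > 0`: eventually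
in `x : ℕ`, for all `1 ≤ m ≤ x < p₀ ≤ x²` and all frequencies `(ξ,ξ'), (τ,τ')` in the cube
`InCube √(log x)` (indexed by the free slots `ℓ ≠ i`):
`‖(log x)^{k−1} (log y)^{k−1} K − 𝔖⁷ M(ξ,ξ') M(τ,τ')‖ ≤ η 𝔖⁷ ‖M(ξ,ξ') M(τ,τ')‖`, where
`K = coupledFreqKernelW phiInv (P_w) m (restrictPairs i i (couplingSet7 p₀ i)) x y`, `M = pairModel`
and `𝔖⁷ = singSmall (k−1) x · nuProd7 k x m p₀ i > 0`.
[cite: Maynard2016LargeGaps, Lemma 7 (proof, displays (6.16)–(6.18))] -/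
theorem eventually_norm_kernelW7_sub_model_le {ε : ℝ} (hε0 : 0 < ε) (hε : ε ≤ 1 / 2) (k : ℕ)
    (i : Fin k) {η : ℝ} (hη : 0 < η) :
    ∀ᶠ x : ℕ in atTop, ∀ m p₀ : ℕ, 1 ≤ m → m ≤ x → x < p₀ → (p₀ : ℝ) ≤ (x : ℝ) ^ 2 →
      ∀ p : ({l : Fin k // l ≠ i} → ℝ × ℝ) × ({l : Fin k // l ≠ i} → ℝ × ℝ),
        InCube (Real.sqrt (Real.log x)) p.1 → InCube (Real.sqrt (Real.log x)) p.2 →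
          ‖(Real.log x : ℂ) ^ (k - 1) * (Real.log (y ε x) : ℂ) ^ (k - 1) *
                coupledFreqKernelW phiInv (Pw x) m (restrictPairs i i (couplingSet7 k x m p₀ i))
                  (x : ℝ) (y ε x) p -
              ((singSmall (k - 1) x * nuProd7 k x m p₀ i : ℝ) : ℂ) * (pairModel p.1 * pairModel p.2)‖ ≤
            η * (singSmall (k - 1) x * nuProd7 k x m p₀ i) * ‖pairModel p.1 * pairModel p.2‖ := by
  have hε1 : ε < 1 := by linarith
  have hcard : Fintype.card {l : Fin k // l ≠ i} = k - 1 := card_slots_ne_eq k i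
  -- accuracy `δ` for each factor
  set δ : ℝ := min 1 (η / 15) with hδ
  have hδpos : 0 < δ := lt_min one_pos (by positivity)
  have hδ1 : δ ≤ 1 := min_le_left _ _
  have hδη : 15 * δ ≤ η := by have := min_le_right 1 (η / 15); rw [← hδ] at this; linarith
  have hlogδ : 0 < Real.log (1 + δ) := Real.log_pos (by linarith)
  set cτ : ℝ := 1 + 2 * π with hcτ
  have hcτ1 : 1 ≤ cτ := by rw [hcτ]; linarith [Real.pi_pos]
  have hcτ0 : 0 < cτ := by linarith
  filter_upwards [eventually_epsTotalW7_le hε1 k (div_pos hlogδ hcτ0),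
    eventually_norm_prod_zetaRatioW_sub_one_le (ι := {l : Fin k // l ≠ i}) hε1 hδpos,
    eventually_le_p0 ((7 * k : ℕ) : ℝ), eventually_le_p0 (2 : ℝ), eventually_iteratedLogs,
    eventually_y_lt_half hε0 (by linarith), eventually_ge_atTop 16, eventually_hTuple_le k]
    with x hT hR hp07 hp02 hlogs hyx hx16 hH
  obtain ⟨hL, hL₂, hL₃, hL₃L₂, hL₂L, -, -⟩ := hlogs
  intro m p₀ hm1 hm hxp hp2 p hp1 hpp2
  have hSS := singSmall_pos (k - 1) x
  have hNN := nuProd7_pos k x m p₀ i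
  -- basic real quantities
  have hx0 : (0 : ℝ) < x := by exact_mod_cast (show 0 < x by omega)
  have hx1 : (1 : ℝ) < x := by exact_mod_cast (show 1 < x by omega)
  have hL0 : 0 < Real.log x := by linarith
  have hR1 : 1 ≤ Real.sqrt (Real.log x) := by
    rw [show (1 : ℝ) = Real.sqrt 1 from Real.sqrt_one.symm]; exact Real.sqrt_le_sqrt (by linarith)
  have hly : 0 < Real.log (y ε x) := by
    rw [log_y]; exact mul_pos (by linarith) (div_pos (mul_pos hL0 (by linarith)) (by linarith))
  have hy1 : 1 < y ε x := by
    by_contra h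
    exact absurd (Real.log_nonpos (Real.exp_pos _).le (not_lt.1 h)) (not_le.2 hly)
  have hyx' : y ε x ≤ x := by linarith
  have hlyx : Real.log (y ε x) ≤ Real.log x := Real.log_le_log (by linarith) hyx'
  have hW : Pw x ≠ 0 := Pw_ne_zero x
  -- names
  set M := restrictPairs i i (couplingSet7 k x m p₀ i) with hM
  set a := expA (x : ℝ) p.1 with ha
  set b := expB (x : ℝ) p.1 with hb
  set a' := expA (y ε x) p.2 with ha'
  set b' := expB (y ε x) p.2 with hb'
  -- (1) `K = E · N · Z · Z'`
  set σ : ℝ := 1 / Real.log x with hσ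
  have hσ0 : 0 < σ := by positivity
  have habσ : ∀ j, σ ≤ (a j).re ∧ σ ≤ (b j).re := fun j => by
    rw [ha, hb, (expA_re_expB_re (x : ℝ) p.1 j).1, (expA_re_expB_re (x : ℝ) p.1 j).2]
    exact ⟨hσ.le, hσ.le⟩
  have hab'σ : ∀ j, σ ≤ (a' j).re ∧ σ ≤ (b' j).re := fun j => by
    rw [ha', hb', (expA_re_expB_re (y ε x) p.2 j).1, (expA_re_expB_re (y ε x) p.2 j).2, hσ]
    exact ⟨one_div_le_one_div_of_le hly hlyx, one_div_le_one_div_of_le hly hlyx⟩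
  have hab0 : ∀ j, 0 ≤ (a j).re ∧ 0 ≤ (b j).re := fun j =>
    ⟨hσ0.le.trans (habσ j).1, hσ0.le.trans (habσ j).2⟩
  have hab'0 : ∀ j, 0 ≤ (a' j).re ∧ 0 ≤ (b' j).re := fun j =>
    ⟨hσ0.le.trans (hab'σ j).1, hσ0.le.trans (hab'σ j).2⟩
  have hp2' : 2 ≤ p0 x := by exact_mod_cast hp02
  have hp7' : 7 * Fintype.card {l : Fin k // l ≠ i} ≤ p0 x := by
    rw [hcard]
    have h7 : 7 * k ≤ p0 x := by exact_mod_cast hp07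
    exact le_trans (Nat.mul_le_mul_left 7 (Nat.sub_le k 1)) h7
  have hWp : ∀ r : ℕ, r.Prime → ¬ r ∣ Pw x → p0 x ≤ r := fun r hr h => p0_le_of_not_dvd_Pw hr h
  set τ : ℝ := (2 + 4 * π) * Real.sqrt (Real.log x) / Real.log (y ε x) with hτ
  have hτ0 : 0 ≤ τ := by rw [hτ]; positivity
  have haτ : ∀ j, ‖a j‖ ≤ τ := fun j =>
    (norm_sOf_div_le_of_inCube hR1 hly hlyx hp1 j).1
  have ha'τ : ∀ j, ‖a' j‖ ≤ τ := fun j =>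
    (norm_sOf_div_le_of_inCube hR1 hly le_rfl hpp2 j).1
  have hBad : ∀ r : ℕ, r.Prime → ¬ r ∣ Pw x → r ∉ badPrimes7 k x m p₀ i → ¬ r ∣ m ∧ M r = ∅ :=
    fun r hr _ hB => badPrimes7_spec hm1 hxp hH i r hr hB
  have hK : coupledFreqKernelW phiInv (Pw x) m M (x : ℝ) (y ε x) p =
      coupledEpsProdW phiInv (Pw x) m M a b a' b' * nuProd (Pw x) m M (badPrimes7 k x m p₀ i) *
        (zetaLimit (Pw x) a b * zetaLimit (Pw x) a' b') :=
    coupledKernelW_eq_prod isLcmWeight_phiInv hW M hσ0 habσ hab'σ hp2' hp7' hp7' hWp hτ0 haτ ha'τ hBad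
  -- (2) `‖E − 1‖ ≤ δ`
  set E := coupledEpsProdW phiInv (Pw x) m M a b a' b' with hE
  have hE1 : ‖E - 1‖ ≤ δ := by
    have h := norm_coupledEpsProdW_sub_one_le isLcmWeight_phiInv hab0 hab'0 hp2' hp7' hp7' hWp hτ0
      haτ ha'τ hBad
    rw [hcard] at h
    refine h.trans ?_
    have hτ' : τ = cτ * tauX ε x := by rw [hτ, hcτ]; unfold tauX; ring
    have hT' : epsTotalW (k - 1) (k - 1) (p0 x) τ (badPrimes7 k x m p₀ i) ≤ Real.log (1 + δ) := by
      rw [hτ']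
      refine (epsTotalW_mul_le (k - 1) (k - 1) (p0 x) (tauX ε x) hcτ1 _).trans ?_
      have := hT m p₀ i hm1 hm hxp hp2
      calc cτ * epsTotalW (k - 1) (k - 1) (p0 x) (tauX ε x) (badPrimes7 k x m p₀ i)
          ≤ cτ * (Real.log (1 + δ) / cτ) := mul_le_mul_of_nonneg_left this hcτ0.le
        _ = Real.log (1 + δ) := mul_div_cancel₀ _ hcτ0.ne'
    calc Real.exp (epsTotalW (k - 1) (k - 1) (p0 x) τ (badPrimes7 k x m p₀ i)) - 1
        ≤ Real.exp (Real.log (1 + δ)) - 1 := by gcongr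
      _ = δ := by rw [Real.exp_log (by linarith)]; ring
  -- (3) `N = nuProd7` exactly (`ν = 1`)
  have hNc : nuProd (Pw x) m M (badPrimes7 k x m p₀ i) = (1 : ℂ) * (nuProd7 k x m p₀ i : ℂ) := by
    rw [hM, nuProd_seven_eq_ofReal, one_mul]
  have hν1 : ‖(1 : ℂ) - 1‖ ≤ δ := by rw [sub_self, norm_zero]; exact hδpos.le
  -- (4) the two `ζ`-products
  obtain ⟨hN1, hR1⟩ := hR (x : ℝ) hlyx p.1 hp1
  obtain ⟨hN2, hR2⟩ := hR (y ε x) le_rfl p.2 hpp2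
  set c : ℝ := (Nat.totient (Pw x) : ℝ) / Pw x with hc
  have hc0 : 0 < c := totient_div_Pw_pos x
  have hZ1 := pow_mul_zetaLimit_eq_pairModel hW hx1 p.1 hN1
  have hZ2 := pow_mul_zetaLimit_eq_pairModel hW hy1 p.2 hN2
  rw [hcard] at hZ1 hZ2
  set R₁ := ∏ j, zetaRatioW (Pw x) (Real.log x) (p.1 j) with hR₁
  set R₂ := ∏ j, zetaRatioW (Pw x) (Real.log (y ε x)) (p.2 j) with hR₂
  set Z₁ := zetaLimit (Pw x) a b with hZ₁
  set Z₂ := zetaLimit (Pw x) a' b' with hZ₂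
  set M₁ := pairModel p.1 with hM₁
  set M₂ := pairModel p.2 with hM₂
  -- `singSmall (k−1) · c^{2(k−1)} = 1`
  have hSc : (singSmall (k - 1) x : ℂ) * (c : ℂ) ^ (2 * (k - 1)) = 1 := by
    have : singSmall (k - 1) x * c ^ (2 * (k - 1)) = 1 := by
      rw [singSmall_eq_inv_pow, ← hc, inv_mul_cancel₀ (pow_ne_zero _ hc0.ne')]
    exact_mod_cast this
  -- (5) algebra: `X − T = 𝔖⁷ M₁ M₂ (E ν R₁ R₂ − 1)`
  have hZ1' : ((c : ℂ) * (Real.log x : ℂ)) ^ (k - 1) * Z₁ = M₁ * R₁ := by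
    rw [hZ₁, ha, hb, hM₁, hR₁, ← hZ1, hc]; push_cast; ring
  have hZ2' : ((c : ℂ) * (Real.log (y ε x) : ℂ)) ^ (k - 1) * Z₂ = M₂ * R₂ := by
    rw [hZ₂, ha', hb', hM₂, hR₂, ← hZ2, hc]; push_cast; ring
  have hX : (Real.log x : ℂ) ^ (k - 1) * (Real.log (y ε x) : ℂ) ^ (k - 1) *
        coupledFreqKernelW phiInv (Pw x) m M (x : ℝ) (y ε x) p -
      ((singSmall (k - 1) x * nuProd7 k x m p₀ i : ℝ) : ℂ) * (M₁ * M₂) =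
      ((singSmall (k - 1) x * nuProd7 k x m p₀ i : ℝ) : ℂ) * (M₁ * M₂) * (E * 1 * R₁ * R₂ - 1) := by
    rw [hK, hNc, Complex.ofReal_mul]
    have hpow : (c : ℂ) ^ (2 * (k - 1)) = (c : ℂ) ^ (k - 1) * (c : ℂ) ^ (k - 1) := by
      rw [two_mul, pow_add]
    rw [hpow] at hSc
    linear_combination ((Real.log x : ℂ) ^ (k - 1) * (Real.log (y ε x) : ℂ) ^ (k - 1) * E *
        ((1 : ℂ) * (nuProd7 k x m p₀ i : ℂ)) * Z₁ * Z₂) * hSc.symm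
      + ((singSmall (k - 1) x : ℂ) * E * (nuProd7 k x m p₀ i : ℂ) * (c : ℂ) ^ (k - 1) *
          (Real.log (y ε x) : ℂ) ^ (k - 1) * Z₂) * (by rw [← hZ1']; ring :
          (c : ℂ) ^ (k - 1) * (Real.log x : ℂ) ^ (k - 1) * Z₁ = M₁ * R₁)
      + ((singSmall (k - 1) x : ℂ) * E * (nuProd7 k x m p₀ i : ℂ) * M₁ * R₁) *
          (by rw [← hZ2']; ring : (c : ℂ) ^ (k - 1) * (Real.log (y ε x) : ℂ) ^ (k - 1) * Z₂ = M₂ * R₂)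
  rw [hX, norm_mul, norm_mul, Complex.norm_real, Real.norm_eq_abs, abs_of_pos (mul_pos hSS hNN)]
  have h4 : ‖E * 1 * R₁ * R₂ - 1‖ ≤ 15 * δ := norm_mul4_sub_one_le7 hδ1 hE1 hν1 hR1 hR2
  have hS0 : 0 ≤ singSmall (k - 1) x * nuProd7 k x m p₀ i * ‖M₁ * M₂‖ := by positivity
  calc singSmall (k - 1) x * nuProd7 k x m p₀ i * ‖M₁ * M₂‖ * ‖E * 1 * R₁ * R₂ - 1‖
      ≤ singSmall (k - 1) x * nuProd7 k x m p₀ i * ‖M₁ * M₂‖ * (15 * δ) :=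
        mul_le_mul_of_nonneg_left h4 hS0
    _ ≤ singSmall (k - 1) x * nuProd7 k x m p₀ i * ‖M₁ * M₂‖ * η :=
        mul_le_mul_of_nonneg_left hδη hS0
    _ = η * (singSmall (k - 1) x * nuProd7 k x m p₀ i) * ‖M₁ * M₂‖ := by ring

end Maynard2016

end Literature.NumberTheory.Sieve

end
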